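import Mathlib
import Summits.KontsevichZagierPeriods.Zeta5Search.SecondOrderAssembly
import Summits.KontsevichZagierPeriods.Zeta5Search.KSecondOrderPair
import HarnessLib

/-!
# ζ(5) search — THEOREM A‴ in `𝒦`-form, assembly: `𝒦/(−p)^{m+3} ≡ −pατ_K(T)`, `V/(−p)^m ≡ −pατ_V(T) (mod p²)` (DENOM-LAW D1, prover-d1 gen 19)

HONEST FRAMING: systematic search; no irrationality claim unless certified.  Cell `pub-zeta5`, track «DENOM-LAW» D1, seat
`denom-prover-d1` gen 19 (`HOME/denom-law/prover-d1/ATTEMPT-19.md` §3).  The `𝒦`-row twin of typer g11's `SecondOrderAssembly.aggregate`,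
valid for EVERY even `M ≥ 4` (the `W`-form needs `M ≥ 6`): under the class hypotheses of `SecondOrder.LawA3` for ONE parameter vector `b`
there are `p`-integral `X, Y` and a scalar `α = ½(Σ_{deep x} ĝ_xφ_x + Σ_{sub-deep y} c_y)` (the SAME `α` as in the `W`-form) with
`‖𝒦_p(b)/(−p)^{3−M} + pX‖ ≤ p⁻²`, `‖V(b)/(−p)^{−M} + pY‖ ≤ p⁻²`, `‖X − ατ_K(T)‖ ≤ p⁻¹`, `‖Y − ατ_V(T)‖ ≤ p⁻¹` (`aggregateK`), where
`𝒦_p = kRes` is the residue part of the ζ(3)-coefficient (`W = Ω_p − 𝒦_p`, `coeffW_eq_omegaRes_sub_kRes`), `X = Σ_{deep} ĝφĉ₂ + Σ_{sub-deep} ĝĉ`,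
and the `𝒦`-DIRECTION `τ_K(T) = 2ĉ₂(T) − Lĉ(T)` replaces `τ_W(T)`.  Inputs: `deepK/subK/restK_norm`, `sub_pair_normK`, `deep_dataK`
(`KSecondOrderPair`, `KSecondOrderLive`), and for the `V`-side verbatim the `W`-form's `deepV/subV/restV_norm`, `deep_data`,
`gHat_pair_second`, `sum_conj_symm`.  Numerical certificate (`g19/code/aggtest.py`): 309/309 instances at `M = 4`, 141/141 at `M = 6`
(`p ≤ 11`, incl. `d < p` and odd-centre live classes).  Nothing about ζ(5), no γ; records in print UNMOVED.
-/

noncomputable section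

open Finset

namespace Summit.KontsevichZagierPeriods.Zeta5Search.SecondOrder

open Summit.KontsevichZagierPeriods.Zeta5Search.WedgeDictionary (coeffV)
open Summit.KontsevichZagierPeriods.Zeta5Search.CasoratianValuation (InPolytope)
open Summit.KontsevichZagierPeriods.Zeta5Search.ClusterValuation
open Summit.KontsevichZagierPeriods.Zeta5Search.PadicSeries

variable {p : ℕ} [hp : Fact p.Prime]

section Agg

variable (b : ℕ → ℤ) (hb : InPolytope b) (hp5 : 5 ≤ p) (hpn : (p : ℤ) ≤ b 0) (hwin : (b 0 + 2 : ℤ) < (p : ℤ) ^ 2)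
  {M : ℕ} (hM : 4 ≤ M) (hMe : Even M) {T : List ℤ} (hT : T.reverse = T)
  (H1 : ∀ x ∈ multipoleClasses b p, -(M : ℤ) ≤ classExp b p x)
  (H2 : ∀ y, y < p → classPoleCount b p y = 1 → -(M : ℤ) + 1 ≤ classNu b p y)
  (H3 : ∀ x ∈ multipoleClasses b p, classExp b p x = -(M : ℤ) → ¬ CentreIn b p x ∧ classTypeList b p x = T)
  (H4 : ∀ y, y < p → 1 ≤ classPoleCount b p y → classNu b p y = -(M : ℤ) + 1 →
    isRaise T (classTypeList b p y) = true ∨ (¬ (2 : ℤ) ∣ b 0 ∧ CentreIn b p y ∧ classTypeList b p y = T))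
include hb hp5 hpn hwin hM hMe hT H1 H2 H3 H4

/-- **AGGREGATION IN `𝒦`-FORM (THEOREM A‴ for one parameter vector, `M ≥ 4` even).**  There are `p`-integral `X`, `Y` and a scalar `α`
with `𝒦_p/(−p)^{3−M} ≡ −pX`, `V/(−p)^{−M} ≡ −pY (mod p²)` and `X ≡ ατ_K(T)`, `Y ≡ ατ_V(T) (mod p)`. -/
theorem aggregateK : ∃ α X Y : ℚ, padicNorm p X ≤ 1 ∧ padicNorm p Y ≤ 1 ∧
    padicNorm p (kRes b p / (-(p : ℚ)) ^ (-(M : ℤ) + 3) + (p : ℚ) * X) ≤ (p : ℚ) ^ (-(2 : ℤ)) ∧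
    padicNorm p (coeffV b / (-(p : ℚ)) ^ (-(M : ℤ)) + (p : ℚ) * Y) ≤ (p : ℚ) ^ (-(2 : ℤ)) ∧
    padicNorm p (X - α * (2 * typeC2 (tTop T) (tList T) - (tTop T : ℚ) * typeC (tTop T) (tList T))) ≤ (p : ℚ) ^ (-(1 : ℤ)) ∧
    padicNorm p (Y - α * typeTauV (tTop T) (tList T)) ≤ (p : ℚ) ^ (-(1 : ℤ)) := by
  have h0 : 0 ≤ b 0 := hb.1.1
  have hp0 : 0 < p := hp.out.pos
  have hp2 : p ≠ 2 := by omega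
  have hpQ : (p : ℚ) ≠ 0 := Nat.cast_ne_zero.2 hp.out.ne_zero
  obtain ⟨-, -, -, hn⟩ := thmA_data b hb hwin
  have hpn' : p ≤ (b 0).toNat := by omega
  have h2n : padicNorm p (2 : ℚ) = 1 := padicNorm_two hp2
  have hhalf : padicNorm p ((1 : ℚ) / 2) = 1 := by rw [padicNorm.div, padicNorm.one, h2n, div_one]
  set m : ℤ := -(M : ℤ) with hm
  set tK : ℚ := 2 * typeC2 (tTop T) (tList T) - (tTop T : ℚ) * typeC (tTop T) (tList T) with htK
  set tV := typeTauV (tTop T) (tList T) with htV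
  set D := (range p).filter (fun x => 2 ≤ classPoleCount b p x ∧ classExp b p x = m) with hD
  set S := (range p).filter (fun y => 1 ≤ classPoleCount b p y ∧ classExp b p y = m + 1) with hS
  have hDsub : D ⊆ range p := filter_subset _ _
  have hSsub : S ⊆ range p := filter_subset _ _
  -- integrality of the ingredients
  have hg1 : ∀ x, x < p → padicNorm p (gHat b p x) ≤ 1 := fun x hx =>
    LevelClass.padicNorm_gHat_le_one b hb hp5 hx
      (mem_filter.2 ⟨mem_range.2 (by have := le_b0_of_lt b hpn hx; omega), rfl⟩)
  have hφ1 : ∀ x, padicNorm p (phiHat b p x) ≤ 1 := fun x => padicNorm_phiHat_le_one b hp2 x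
  have hc1 : ∀ z, padicNorm p (cHat b p z) ≤ 1 := fun z => padicNorm_cHat_le_one b h0 hn hp2 z
  have hv1 : ∀ z, padicNorm p (vHat b p z) ≤ 1 := fun z => LevelClass.padicNorm_vHat_le_one b h0 hn hp2
  have hc21 : ∀ z, padicNorm p (cHat2 b p z) ≤ 1 := fun z => padicNorm_cHat2_le_one b h0 hn hp2 z
  have hv21 : ∀ z, padicNorm p (vHat2 b p z) ≤ 1 := fun z => padicNorm_vHat2_le_one b h0 hn hp2 z
  -- ### deep classes
  have hDmem : ∀ x ∈ D, x < p ∧ 2 ≤ classPoleCount b p x ∧ classExp b p x = m := fun x hx => by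
    obtain ⟨hxr, h⟩ := mem_filter.1 hx; exact ⟨mem_range.1 hxr, h⟩
  have hdeep : ∀ x ∈ D, cHat b p x = 0 ∧ cHat2 b p x = tK / 2 ∧
      vHat2 b p x - (topLevel b p x : ℚ) / 2 * vHat b p x = tV / 2 ∧ vHat b p (conjClass b p x) = vHat b p x ∧
      ¬ CentreIn b p x := by
    intro x hx
    obtain ⟨hxp, h2, hE⟩ := hDmem x hx
    obtain ⟨hc, htl⟩ := H3 x (mem_filter.2 ⟨mem_range.2 hxp, h2⟩) hE
    have hodd : Odd (3 + classExp b p x) := by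
      rw [hE, hm]; obtain ⟨r, hr⟩ := hMe; exact ⟨1 - (r : ℤ), by omega⟩
    have heven : Even (classExp b p x) := by rw [hE, hm]; obtain ⟨r, hr⟩ := hMe; exact ⟨-(r : ℤ), by omega⟩
    obtain ⟨-, -, htv, hvc⟩ := deep_data b hb hpn hT hxp hc htl hodd
    obtain ⟨hc0, hT0, hc2⟩ := deep_dataK b hb hp5 hpn hwin hT hxp hc htl (by omega) heven
    unfold tauV at htv
    refine ⟨hc0, by rw [hc2, htK, hT0]; ring, by rw [htV, ← htv]; ring, hvc, hc⟩
  -- ### the per-class models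
  set MK : ℕ → ℚ := fun x =>
    (if x ∈ D then gHat b p x * (cHat b p x - (p : ℚ) * phiHat b p x * cHat2 b p x) else 0)
      + (if x ∈ S then -((p : ℚ) * gHat b p x * cHat b p x) else 0) with hMK
  set MV : ℕ → ℚ := fun x =>
    (if x ∈ D then gHat b p x * (vHat b p x - (p : ℚ) * phiHat b p x * vHat2 b p x) else 0)
      + (if x ∈ S then -((p : ℚ) * gHat b p x * vHat b p x) else 0) with hMV
  have hclass : ∀ x ∈ range p,
      padicNorm p (classK b p x / (-(p : ℚ)) ^ (m + 3) - MK x) ≤ (p : ℚ) ^ (-(2 : ℤ)) ∧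
      padicNorm p (classV b p x / (-(p : ℚ)) ^ m - MV x) ≤ (p : ℚ) ^ (-(2 : ℤ)) := by
    intro x hxr
    have hxp := mem_range.1 hxr
    by_cases hxD : x ∈ D
    · obtain ⟨-, h2, hE⟩ := hDmem x hxD
      have hxS : x ∉ S := fun h => by have := (mem_filter.1 h).2.2; omega
      have e1 : MK x = gHat b p x * (cHat b p x - (p : ℚ) * phiHat b p x * cHat2 b p x) := by
        simp only [hMK, if_pos hxD, if_neg hxS, add_zero]
      have e2 : MV x = gHat b p x * (vHat b p x - (p : ℚ) * phiHat b p x * vHat2 b p x) := by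
        simp only [hMV, if_pos hxD, if_neg hxS, add_zero]
      rw [e1, e2, ← hE]
      exact ⟨deepK_norm b hb hp5 hwin hxp (by omega), deepV_norm b hb hp5 hwin hxp (by omega) (by omega)⟩
    by_cases hxS : x ∈ S
    · obtain ⟨-, h1, hE⟩ := mem_filter.1 hxS
      have e1 : MK x = -((p : ℚ) * gHat b p x * cHat b p x) := by simp only [hMK, if_neg hxD, if_pos hxS, zero_add]
      have e2 : MV x = -((p : ℚ) * gHat b p x * vHat b p x) := by simp only [hMV, if_neg hxD, if_pos hxS, zero_add]
      rw [e1, e2, sub_neg_eq_add, sub_neg_eq_add]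
      exact ⟨subK_norm b hb hp5 hwin hxp h1 hE (by omega), subV_norm b hb hp5 hwin hxp h1 hE⟩
    · have e1 : MK x = 0 := by simp only [hMK, if_neg hxD, if_neg hxS, add_zero]
      have e2 : MV x = 0 := by simp only [hMV, if_neg hxD, if_neg hxS, add_zero]
      rw [e1, e2, sub_zero, sub_zero]
      have hrestE : 2 ≤ classPoleCount b p x → m + 2 ≤ classExp b p x := by
        intro h2
        have hge := H1 x (mem_filter.2 ⟨hxr, h2⟩)
        have hne1 : classExp b p x ≠ m := fun h => hxD (mem_filter.2 ⟨hxr, h2, h⟩)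
        have hne2 : classExp b p x ≠ m + 1 := fun h => hxS (mem_filter.2 ⟨hxr, by omega, h⟩)
        omega
      refine ⟨restK_norm b hb hp5 hwin hxp (by omega) hrestE, restV_norm b hb hp5 hwin hxp fun h1 => ?_⟩
      by_cases h2 : 2 ≤ classPoleCount b p x
      · exact (hrestE h2).trans (CellA.classExp_le_classNu b p x)
      · have hone : classPoleCount b p x = 1 := by omega
        have hnu := H2 x hxp hone
        by_contra hlt
        have hnu1 : classNu b p x = m + 1 := by omega
        by_cases heq : classNu b p x = classExp b p x
        · exact hxS (mem_filter.2 ⟨hxr, h1, by rw [← heq, hnu1]⟩)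
        · have := (tame_of_classNu_ne b heq).2; omega
  -- ### the sums of the models
  set AD := ∑ x ∈ D, gHat b p x * phiHat b p x with hAD
  set CS := ∑ y ∈ S, pairCoeff b p M y with hCS
  set X := (∑ x ∈ D, gHat b p x * phiHat b p x * cHat2 b p x) + ∑ y ∈ S, gHat b p y * cHat b p y with hX
  set Y := (∑ x ∈ D, gHat b p x * phiHat b p x * (vHat2 b p x - (topLevel b p x : ℚ) / 2 * vHat b p x))
    + ∑ y ∈ S, gHat b p y * vHat b p y with hY
  have hSK : ∑ x ∈ range p, MK x = -((p : ℚ) * X) := by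
    have e : ∑ x ∈ range p, MK x = (∑ x ∈ D, gHat b p x * (cHat b p x - (p : ℚ) * phiHat b p x * cHat2 b p x))
        + ∑ y ∈ S, -((p : ℚ) * gHat b p y * cHat b p y) := by
      rw [hMK, sum_add_distrib, sum_ite_mem_subset hDsub, sum_ite_mem_subset hSsub]
    have hD0 : ∑ x ∈ D, gHat b p x * (cHat b p x - (p : ℚ) * phiHat b p x * cHat2 b p x) =
        -((p : ℚ) * ∑ x ∈ D, gHat b p x * phiHat b p x * cHat2 b p x) := by
      rw [Finset.mul_sum, ← sum_neg_distrib]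
      exact sum_congr rfl fun x hx => by rw [(hdeep x hx).1]; ring
    have hS0 : ∑ y ∈ S, -((p : ℚ) * gHat b p y * cHat b p y) = -((p : ℚ) * ∑ y ∈ S, gHat b p y * cHat b p y) := by
      rw [Finset.mul_sum, ← sum_neg_distrib]
      exact sum_congr rfl fun y _ => by ring
    rw [e, hX, hD0, hS0]; ring
  -- the deep `V`-terms need the pair weight: `Σ_D ĝv̂ ≡ (p/2) Σ_D Lφĝv̂ (mod p²)`
  have hDconj : ∀ x ∈ D, conjClass b p x ∈ D := fun x hx =>
    conj_mem_filter b h0 hp0 hpn' (P := fun c E => 2 ≤ c ∧ E = m) hx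
  have hSconj : ∀ y ∈ S, conjClass b p y ∈ S := fun y hy =>
    conj_mem_filter b h0 hp0 hpn' (P := fun c E => 1 ≤ c ∧ E = m + 1) hy
  have hDv : padicNorm p ((∑ x ∈ D, gHat b p x * vHat b p x)
      - (p : ℚ) / 2 * ∑ x ∈ D, (topLevel b p x : ℚ) * phiHat b p x * gHat b p x * vHat b p x) ≤ (p : ℚ) ^ (-(2 : ℤ)) := by
    have h2s := sum_conj_symm b hpn' D (fun x hx => (hDmem x hx).1) hDconj (fun x => gHat b p x * vHat b p x)
    have e : (∑ x ∈ D, gHat b p x * vHat b p x)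
        - (p : ℚ) / 2 * ∑ x ∈ D, (topLevel b p x : ℚ) * phiHat b p x * gHat b p x * vHat b p x =
        (1 : ℚ) / 2 * ∑ x ∈ D, ((gHat b p x + gHat b p (conjClass b p x)
          - (topLevel b p x : ℚ) * p * phiHat b p x * gHat b p x) * vHat b p x) := by
      have : ∑ x ∈ D, (gHat b p x * vHat b p x + gHat b p (conjClass b p x) * vHat b p (conjClass b p x)) =
          ∑ x ∈ D, (gHat b p x + gHat b p (conjClass b p x)) * vHat b p x :=
        sum_congr rfl fun x hx => by rw [(hdeep x hx).2.2.2.1]; ring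
      have h3 : ∑ x ∈ D, gHat b p x * vHat b p x =
          (1 : ℚ) / 2 * ∑ x ∈ D, (gHat b p x + gHat b p (conjClass b p x)) * vHat b p x := by
        rw [← this, ← h2s]; ring
      have h4 : (1 : ℚ) / 2 * (∑ x ∈ D, (gHat b p x + gHat b p (conjClass b p x)) * vHat b p x)
          - (p : ℚ) / 2 * ∑ x ∈ D, (topLevel b p x : ℚ) * phiHat b p x * gHat b p x * vHat b p x =
          (1 : ℚ) / 2 * ∑ x ∈ D, ((gHat b p x + gHat b p (conjClass b p x)
            - (topLevel b p x : ℚ) * p * phiHat b p x * gHat b p x) * vHat b p x) := by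
        rw [Finset.mul_sum, Finset.mul_sum, Finset.mul_sum, ← sum_sub_distrib]
        exact sum_congr rfl fun x _ => by ring
      rw [h3, h4]
    rw [e, padicNorm.mul, hhalf, one_mul]
    refine padicNorm.sum_le' (fun x hx => ?_) (zpow_p_nonneg _)
    obtain ⟨hxp, -, hE⟩ := hDmem x hx
    have hxn := le_b0_of_lt b hpn hxp
    obtain ⟨hL, hL'⟩ := level_bounds' (p := p) b hxn
    have heven : Even (classExp b p x) := by rw [hE, hm]; obtain ⟨r, hr⟩ := hMe; exact ⟨-(r : ℤ), by omega⟩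
    have hpair := gHat_pair_second b hb hp5 hxp hL hL' (hdeep x hx).2.2.2.2 heven
    rw [padicNorm.mul]
    calc _ ≤ (p : ℚ) ^ (-(2 : ℤ)) * 1 := mul_le_mul hpair (hv1 _) (padicNorm.nonneg _) (zpow_p_nonneg _)
      _ = _ := mul_one _
  have hSV : padicNorm p (∑ x ∈ range p, MV x + (p : ℚ) * Y) ≤ (p : ℚ) ^ (-(2 : ℤ)) := by
    have e : ∑ x ∈ range p, MV x + (p : ℚ) * Y = (∑ x ∈ D, gHat b p x * vHat b p x)
        - (p : ℚ) / 2 * ∑ x ∈ D, (topLevel b p x : ℚ) * phiHat b p x * gHat b p x * vHat b p x := by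
      have eMV : ∑ x ∈ range p, MV x = (∑ x ∈ D, gHat b p x * (vHat b p x - (p : ℚ) * phiHat b p x * vHat2 b p x))
          + ∑ y ∈ S, -((p : ℚ) * gHat b p y * vHat b p y) := by
        rw [hMV, sum_add_distrib, sum_ite_mem_subset hDsub, sum_ite_mem_subset hSsub]
      have hD1 : (∑ x ∈ D, gHat b p x * (vHat b p x - (p : ℚ) * phiHat b p x * vHat2 b p x))
          + (p : ℚ) * ∑ x ∈ D, gHat b p x * phiHat b p x * (vHat2 b p x - (topLevel b p x : ℚ) / 2 * vHat b p x) =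
          (∑ x ∈ D, gHat b p x * vHat b p x)
            - (p : ℚ) / 2 * ∑ x ∈ D, (topLevel b p x : ℚ) * phiHat b p x * gHat b p x * vHat b p x := by
        rw [Finset.mul_sum, Finset.mul_sum, ← sum_add_distrib, ← sum_sub_distrib]
        exact sum_congr rfl fun x _ => by ring
      have hS1 : (∑ y ∈ S, -((p : ℚ) * gHat b p y * vHat b p y)) + (p : ℚ) * ∑ y ∈ S, gHat b p y * vHat b p y = 0 := by
        rw [Finset.mul_sum, ← sum_add_distrib]
        exact sum_eq_zero fun y _ => by ring
      rw [eMV, hY, mul_add]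
      linear_combination hD1 + hS1
    rw [e]; exact hDv
  -- ### `X ≡ α τ_K`, `Y ≡ α τ_V`
  have hSpair : padicNorm p ((2 * ∑ y ∈ S, gHat b p y * cHat b p y) - CS * tK) ≤ (p : ℚ) ^ (-(1 : ℤ)) ∧
      padicNorm p ((2 * ∑ y ∈ S, gHat b p y * vHat b p y) - CS * tV) ≤ (p : ℚ) ^ (-(1 : ℤ)) := by
    rw [sum_conj_symm b hpn' S (fun y hy => mem_range.1 (hSsub hy)) hSconj,
      sum_conj_symm b hpn' S (fun y hy => mem_range.1 (hSsub hy)) hSconj, hCS, sum_mul, sum_mul, ← sum_sub_distrib,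
      ← sum_sub_distrib]
    constructor
    · refine padicNorm.sum_le' (fun y hy => ?_) (zpow_p_nonneg _)
      obtain ⟨hyr, h1, hE⟩ := mem_filter.1 hy
      exact (sub_pair_normK b hb hp5 hpn hwin hM hMe hT H4 (mem_range.1 hyr) h1 hE).1
    · refine padicNorm.sum_le' (fun y hy => ?_) (zpow_p_nonneg _)
      obtain ⟨hyr, h1, hE⟩ := mem_filter.1 hy
      exact (sub_pair_normK b hb hp5 hpn hwin hM hMe hT H4 (mem_range.1 hyr) h1 hE).2
  refine ⟨(AD + CS) / 2, X, Y, ?_, ?_, ?_, ?_, ?_, ?_⟩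
  · -- `X` is integral
    rw [hX]
    refine (padicNorm.nonarchimedean (p := p)).trans (max_le ?_ ?_)
    · refine padicNorm.sum_le' (fun x hx => ?_) zero_le_one
      rw [padicNorm.mul, padicNorm.mul]
      calc _ ≤ (1 : ℚ) * 1 * 1 := mul_le_mul (mul_le_mul (hg1 x (hDmem x hx).1) (hφ1 x) (padicNorm.nonneg _) zero_le_one)
            (hc21 x) (padicNorm.nonneg _) (by norm_num)
        _ = 1 := by ring
    · refine padicNorm.sum_le' (fun y hy => ?_) zero_le_one
      rw [padicNorm.mul]
      calc _ ≤ (1 : ℚ) * 1 := mul_le_mul (hg1 y (mem_range.1 (hSsub hy))) (hc1 y) (padicNorm.nonneg _) zero_le_one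
        _ = 1 := one_mul _
  · -- `Y` is integral
    rw [hY]
    refine (padicNorm.nonarchimedean (p := p)).trans (max_le ?_ ?_)
    · refine padicNorm.sum_le' (fun x hx => ?_) zero_le_one
      have hin : padicNorm p (vHat2 b p x - (topLevel b p x : ℚ) / 2 * vHat b p x) ≤ 1 := by
        refine (padicNorm.sub (p := p)).trans (max_le (hv21 x) ?_)
        rw [padicNorm.mul, padicNorm.div, h2n, div_one]
        calc _ ≤ (1 : ℚ) * 1 := mul_le_mul (by simpa using padicNorm.of_nat (p := p) (topLevel b p x)) (hv1 x)
              (padicNorm.nonneg _) zero_le_one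
          _ = 1 := one_mul _
      rw [padicNorm.mul, padicNorm.mul]
      calc _ ≤ (1 : ℚ) * 1 * 1 := mul_le_mul (mul_le_mul (hg1 x (hDmem x hx).1) (hφ1 x) (padicNorm.nonneg _) zero_le_one)
            hin (padicNorm.nonneg _) (by norm_num)
        _ = 1 := by ring
    · refine padicNorm.sum_le' (fun y hy => ?_) zero_le_one
      rw [padicNorm.mul]
      calc _ ≤ (1 : ℚ) * 1 := mul_le_mul (hg1 y (mem_range.1 (hSsub hy))) (hv1 y) (padicNorm.nonneg _) zero_le_one
        _ = 1 := one_mul _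
  · -- `𝒦/(−p)^{m+3} + pX = Σ_x (𝒦_x/(−p)^{m+3} − MK x)`
    have e : kRes b p / (-(p : ℚ)) ^ (-(M : ℤ) + 3) + (p : ℚ) * X =
        ∑ x ∈ range p, (classK b p x / (-(p : ℚ)) ^ (m + 3) - MK x) := by
      rw [sum_sub_distrib, hSK, kRes_eq_sum_classK b hp0, sum_div]; ring
    rw [e]
    exact padicNorm.sum_le' (fun x hx => (hclass x hx).1) (zpow_p_nonneg _)
  · have e : coeffV b / (-(p : ℚ)) ^ (-(M : ℤ)) + (p : ℚ) * Y =
        (∑ x ∈ range p, (classV b p x / (-(p : ℚ)) ^ m - MV x)) + (∑ x ∈ range p, MV x + (p : ℚ) * Y) := by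
      rw [sum_sub_distrib, coeffV_eq_sum_classV b hp0, sum_div]; ring
    rw [e]
    exact (padicNorm.nonarchimedean (p := p)).trans
      (max_le (padicNorm.sum_le' (fun x hx => (hclass x hx).2) (zpow_p_nonneg _)) hSV)
  · -- `X − α τ_K = ½ (2Σ_S ĝĉ − CS τ_K)` since `ĉ₂ = τ_K/2` on deep classes
    have e : X - (AD + CS) / 2 * tK = (1 : ℚ) / 2 * ((2 * ∑ y ∈ S, gHat b p y * cHat b p y) - CS * tK) := by
      have hDsum : ∑ x ∈ D, gHat b p x * phiHat b p x * cHat2 b p x = AD * tK / 2 := by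
        rw [hAD, sum_mul, sum_div]
        exact sum_congr rfl fun x hx => by rw [(hdeep x hx).2.1]; ring
      rw [hX, hDsum]; ring
    rw [e, padicNorm.mul, hhalf, one_mul]
    exact hSpair.1
  · have e : Y - (AD + CS) / 2 * tV = (1 : ℚ) / 2 * ((2 * ∑ y ∈ S, gHat b p y * vHat b p y) - CS * tV) := by
      have hDsum : ∑ x ∈ D, gHat b p x * phiHat b p x * (vHat2 b p x - (topLevel b p x : ℚ) / 2 * vHat b p x) =
          AD * tV / 2 := by
        rw [hAD, sum_mul, sum_div]
        exact sum_congr rfl fun x hx => by rw [(hdeep x hx).2.2.1]; ring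
      rw [hY, hDsum]; ring
    rw [e, padicNorm.mul, hhalf, one_mul]
    exact hSpair.2

end Agg

end Summit.KontsevichZagierPeriods.Zeta5Search.SecondOrder

end
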